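import Summits.BirchSwinnertonDyer.BirchSwinnertonDyer.Theorems.ManinLocalTwoThreeIntegralQSeriesNearCusp
import Summits.BirchSwinnertonDyer.Rank1Residual.ManinAdditive.UDCKummerWitnessLineB
import HarnessLib

/-!
# Integer `q`-series near the cusp for the B-witness `F = B_d · Φ` — (QEXNB) of -an's B-line BY NAME
(route `ManinLocalTwoThree`, crux C3 `ManinPrimeToThreeAtNine` stmt-BirchSwinnertonDyer-22968; cell bsd-f2-manin, prover seat p2 gen 18;
`--supports stmt-BirchSwinnertonDyer-22968`)

-an g38's B-LINE addendum (`UDCKummerWitnessLineB`, typer T-an-45, p730675) cuts the relaxed C3 witness law (WL♭) into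
(INT) ∧ (DICT) ∧ (RATB) ∧ (HOLB) ∧ (QEXNB) ∧ (INVB); (QEXNB) `IntegralQSeriesNearCuspB` is GENERIC bookkeeping: if `Φ = Σ gₘ qᵐ` for `Im τ > B`
with `g ∈ ℤ⟦q⟧` (given as `g ∈ ℚ⟦q⟧` with all denominators `1`), `B_d = Σ bₙ e^{2πiτn}` with INTEGER `bₙ` on all of `ℍ`, and `F = B_d · Φ` for
`Im τ > B'`, then `F = Σ b'ₘ e^{2πiτm}` with INTEGER `b'ₘ` for `Im τ > max B B'`.  This file PROVES it (`integralQSeriesNearCuspB`, and BY NAME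
`integralQSeriesNearCuspB_holds : UDCKummerWitnessLine.IntegralQSeriesNearCuspB`): the Cauchy product of the two integer `q`-series
(the C3 LEAD's `IntegralQSeries.hasSum_intSeries_mul` / `exists_map_eq_of_den_eq_one`, p730250; summability in `ℂ` is absolute).
With (HOLB) `WitnessInvariance.kummerMinimalWitnessExtensionB_holds` (p731758) and (INVB) `WitnessInvariance.kummerMinimalWitnessInvarianceB_holds`
(p731884) this leaves the B-line open exactly at (DICT) and (RATB) (and (INT), closed by name in p730250).

HONEST FRAMING.  Bookkeeping only; (WL♭), C3, Manin's conjecture and BSD are NOT proved here.  No definitions, no sorry. [folklore]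
-/

set_option autoImplicit false
-- lint-debt: the directory name repeats the summit name (sibling precedent `ManinLocalTwoThreeIntegralQSeriesNearCusp.lean`)
set_option linter.dupNamespace false

noncomputable section

open Complex UpperHalfPlane PowerSeries
open scoped Real Topology Manifold MatrixGroups ModularForm

namespace Summit.BirchSwinnertonDyer.BirchSwinnertonDyer.Theorems.ManinLocalTwoThree.IntegralQSeries

/-! ## §1 An integer `exp`-series on `ℍ` is the sum of an integer `q`-series -/

/-- `Σ bₙ e^{2πiτn} = Σ (coeff n K) q(τ)ⁿ` with `K = mk b ∈ ℤ⟦q⟧`. [folklore] -/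
theorem hasSum_intSeries_of_hasSum_exp {Bd : ℍ → ℂ} {bd : ℕ → ℤ} {τ : ℍ}
    (h : HasSum (fun n : ℕ ↦ (bd n : ℂ) * Complex.exp (2 * Real.pi * Complex.I * (τ : ℂ) * n)) (Bd τ)) :
    HasSum (fun m : ℕ ↦ coeff m ((PowerSeries.mk bd).map (Int.castRingHom ℂ)) * Function.Periodic.qParam 1 (τ : ℂ) ^ m)
      (Bd τ) := by
  convert h using 2 with m
  rw [coeff_map, coeff_mk, QExpansionExtension.exp_eq_qParam_pow]
  rfl

/-! ## §2 (QEXNB) -/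

/-- **(QEXNB) integer `q`-series of the B-witness near the cusp**: `Φ = Σ gₘ qᵐ` (`g` integral) for `Im τ > B`, `B_d = Σ bₙ e^{2πiτn}`
(`bₙ ∈ ℤ`) on `ℍ`, `F = B_d · Φ` for `Im τ > B'` ⟹ `F = Σ b'ₘ e^{2πiτm}` with `b'ₘ ∈ ℤ` for `Im τ > max B B'` (Cauchy product). [folklore] -/
theorem integralQSeriesNearCuspB (Φ F Bd : ℍ → ℂ) (g : ℚ⟦X⟧) (bd : ℕ → ℤ)
    (hg : ∀ m, (coeff m g).den = 1)
    (hΦ : ∃ B : ℝ, ∀ τ : ℍ, B < τ.im →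
      HasSum (fun m : ℕ ↦ ((coeff m g : ℚ) : ℂ) * Function.Periodic.qParam 1 (τ : ℂ) ^ m) (Φ τ))
    (hBd : ∀ τ : ℍ, HasSum (fun n : ℕ ↦ (bd n : ℂ) * Complex.exp (2 * Real.pi * Complex.I * (τ : ℂ) * n)) (Bd τ))
    (hF : ∃ B : ℝ, ∀ τ : ℍ, B < τ.im → F τ = Bd τ * Φ τ) :
    ∃ (b : ℕ → ℤ) (B : ℝ), ∀ τ : ℍ, B < τ.im →
      HasSum (fun m : ℕ ↦ (b m : ℂ) * Complex.exp (2 * Real.pi * Complex.I * (τ : ℂ) * m)) (F τ) := by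
  obtain ⟨B₁, hB₁⟩ := hΦ
  obtain ⟨B₂, hB₂⟩ := hF
  obtain ⟨G, hG⟩ := exists_map_eq_of_den_eq_one hg
  refine ⟨fun m ↦ coeff m (PowerSeries.mk bd * G), max B₁ B₂, fun τ hτ ↦ ?_⟩
  have h1 : B₁ < τ.im := lt_of_le_of_lt (le_max_left _ _) hτ
  have h2 : B₂ < τ.im := lt_of_le_of_lt (le_max_right _ _) hτ
  have hΦτ : HasSum (fun m : ℕ ↦ coeff m (G.map (Int.castRingHom ℂ)) * Function.Periodic.qParam 1 (τ : ℂ) ^ m) (Φ τ) := by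
    convert hB₁ τ h1 using 2 with m
    rw [coeff_map, hG m]; rfl
  have hprod := hasSum_intSeries_mul (hasSum_intSeries_of_hasSum_exp (hBd τ)) hΦτ
  rw [← hB₂ τ h2] at hprod
  convert hprod using 2 with m
  rw [coeff_map, QExpansionExtension.exp_eq_qParam_pow]
  rfl

/-! ## §3 (QEXNB) BY NAME -/

open Summit.BirchSwinnertonDyer.Rank1Residual.ManinAdditive in
/-- **(QEXNB) BY NAME** — `UDCKummerWitnessLine.IntegralQSeriesNearCuspB` holds. [folklore] -/
theorem integralQSeriesNearCuspB_holds : UDCKummerWitnessLine.IntegralQSeriesNearCuspB :=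
  fun Φ F Bd g bd hg hΦ hBd hF ↦ integralQSeriesNearCuspB Φ F Bd g bd hg hΦ hBd hF

end Summit.BirchSwinnertonDyer.BirchSwinnertonDyer.Theorems.ManinLocalTwoThree.IntegralQSeries

end
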